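import Literature.Computability.Complexity.StackBricks
import Literature.Computability.Complexity.StackRoutines
import Literature.Computability.Complexity.StackModArith
import HarnessLib

/-!
# String bricks: padded blocks, low bits, unary multiples, canonical completion as `FP` functions

Trunk `CplxCore`, continuing `StackBricks.lean` (`Brick.unOp_mem_FP` / `Brick.binOp_mem_FP`).
Three small loop programs used when an `FP`-algebra machine slices a coin string into fixed-width
blocks, truncates a block to the width of a numeral, or lays out a unary budget (the canonical
completion `canonBits ∈ FP` is filed with its consumer, which imports `ShorOrdPost.canonBits`):

* `padTakeFn ⟨u, c⟩ = ⟨List.takeD |u| c false, c.drop |u|⟩` — the first `|u|` symbols of `c`,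
  padded with `0`s when `c` is short (Batteries' `List.takeD`; `getD_takeD`: symbol `i` is
  `c.getD i false`), and the rest;
* `lowBitsFn ⟨u, v⟩ = norm (v.take |u|)` — as a numeral, `⟦v⟧ mod 2^{|u|}` (`bitsToNat_take`);
* `onesMulFn k w = 1^{k |w|}`;

## References

* S. Arora, B. Barak, *Computational Complexity: A Modern Approach*, CUP 2009, §1.3, §0.1.
* T. Nipkow, G. Klein, *Concrete Semantics with Isabelle/HOL*, Springer 2014, §7.2 (loop rule).
-/

namespace Literature.Computability.Complexity

open _root_.Computability AReg

namespace Brick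

/-- One outer register (accumulator) beside the bank. [folklore] -/
inductive O1
  | acc
  deriving DecidableEq, Fintype, Repr

/-- The two-operand start file over `O1 ⊕ AReg`. [folklore] -/
theorem init2_o1 (a b : List Bool) :
    init2 (Sum.inr AReg.x : O1 ⊕ AReg) (Sum.inr AReg.y) a b = Sum.elim (fun _ => []) (file a b [] [] [] [] [] []) := by
  funext i; rcases i with i | i
  · cases i; rfl
  · cases i <;> rfl

/-- The one-operand start file over `O1 ⊕ AReg`. [folklore] -/
theorem init1_o1 (a : List Bool) :
    init1 (Sum.inr AReg.x : O1 ⊕ AReg) a = Sum.elim (fun _ => []) (file a [] [] [] [] [] [] []) := by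
  funext i; rcases i with i | i
  · cases i; rfl
  · cases i <;> rfl

/-- The outer file of `O1` holding `v`. [folklore] -/
def o1 (v : List Bool) : Regs O1 := fun _ => v

/-- Reading the outer file. [folklore] -/
@[simp] theorem o1_apply (v : List Bool) (i : O1) : o1 v i = v := rfl

/-- Writing the outer file. [folklore] -/
theorem update_o1 (v w : List Bool) : Function.update (o1 v) O1.acc w = o1 w := by
  funext i; cases i; simp

/-- The empty outer file. [folklore] -/
theorem o1_nil : (fun _ : O1 => ([] : List Bool)) = o1 [] := rfl

/-! ### Padded blocks (`List.takeD · · false`) -/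

/-- Symbol `i < n` of `List.takeD n c false` is `c.getD i false`. [folklore] -/
theorem getD_takeD : ∀ (n : ℕ) (c : List Bool) (i : ℕ), i < n → (List.takeD n c false).getD i false = c.getD i false
  | 0, _, _, h => by omega
  | n + 1, [], i, h => by
    rw [List.takeD_nil]
    simp [List.getD_eq_getElem?_getD, h]
  | n + 1, b :: c, 0, _ => by simp
  | n + 1, b :: c, i + 1, h => by
    rw [List.takeD_succ, List.getD_cons_succ, List.getD_cons_succ]
    exact getD_takeD n c i (by omega)

/-- The block loop's body: move one symbol of `y` (or a padding `0`) onto the accumulator.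
[folklore] -/
def padBody : Com (O1 ⊕ AReg) :=
  Com.pop (Sum.inr .y) (Com.push (Sum.inl O1.acc) true) (Com.push (Sum.inl O1.acc) false) (Com.push (Sum.inl O1.acc) false)

/-- One iteration of the block loop. [folklore] -/
theorem runs_padBody (v c xs : List Bool) :
    Com.Runs padBody (Sum.elim (o1 v) (file xs c [] [] [] [] [] []))
      (Sum.elim (o1 (c.headD false :: v)) (file xs c.tail [] [] [] [] [] [])) 3 := by
  rcases c with _ | ⟨b, c⟩
  · exact (Com.Runs.pop_nil _ _ rfl (Com.Runs.push' (R' := Sum.elim (o1 (false :: v)) (file xs [] [] [] [] [] [] []))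
      (by funext i; rcases i with i | i <;> cases i <;> rfl))).of_eq rfl (by omega)
  · have hw : Function.update (Sum.elim (o1 v) (file xs (b :: c) [] [] [] [] [] [])) (Sum.inr AReg.y : O1 ⊕ AReg) c =
        Sum.elim (o1 v) (file xs c [] [] [] [] [] []) := by
      funext i; rcases i with i | i <;> cases i <;> rfl
    have hp : ∀ d : Bool, Com.Runs (Com.push (Sum.inl O1.acc) d : Com (O1 ⊕ AReg)) (Sum.elim (o1 v) (file xs c [] [] [] [] [] []))
        (Sum.elim (o1 (d :: v)) (file xs c [] [] [] [] [] [])) 1 := fun d =>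
      Com.Runs.push' (by funext i; rcases i with i | i <;> cases i <;> rfl)
    cases b
    · exact Com.Runs.pop_false (k := (Sum.inr AReg.y : O1 ⊕ AReg)) _ _ (w := c) rfl (by rw [hw]; exact hp false)
    · exact Com.Runs.pop_true (k := (Sum.inr AReg.y : O1 ⊕ AReg)) _ _ (w := c) rfl (by rw [hw]; exact hp true)

/-- **The block loop**: over the `|u|` symbols of `x`, from accumulator `v`:
`acc := (takeD |u| c false)ʳ ++ v`, `y := c.drop |u|`. [folklore] -/
theorem runs_padLoop (u : List Bool) : ∀ (c v : List Bool),
    Com.Runs (Com.loop (Sum.inr .x) padBody padBody : Com (O1 ⊕ AReg)) (Sum.elim (o1 v) (file u c [] [] [] [] [] []))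
      (Sum.elim (o1 ((List.takeD u.length c false).reverse ++ v)) (file [] (c.drop u.length) [] [] [] [] [] [])) (5 * u.length + 1) := by
  induction u with
  | nil => intro c v; exact (Com.Runs.loop_nil _ _ rfl).of_eq (by simp) (by simp)
  | cons b u ih =>
    intro c v
    have hk : (Sum.elim (o1 v) (file (b :: u) c [] [] [] [] [] []) : Regs (O1 ⊕ AReg)) (Sum.inr AReg.x) = b :: u := rfl
    have hw : Function.update (Sum.elim (o1 v) (file (b :: u) c [] [] [] [] [] [])) (Sum.inr AReg.x : O1 ⊕ AReg) u =
        Sum.elim (o1 v) (file u c [] [] [] [] [] []) := by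
      funext i; rcases i with i | i <;> cases i <;> rfl
    have hbody : Com.Runs padBody (Function.update (Sum.elim (o1 v) (file (b :: u) c [] [] [] [] [] [])) (Sum.inr AReg.x : O1 ⊕ AReg) u)
        (Sum.elim (o1 (c.headD false :: v)) (file u c.tail [] [] [] [] [] [])) 3 := by
      rw [hw]; exact runs_padBody v c u
    have hrest := ih c.tail (c.headD false :: v)
    have e : (List.takeD (b :: u).length c false).reverse ++ v = (List.takeD u.length c.tail false).reverse ++ (c.headD false :: v) := by
      rcases c with _ | ⟨d, c⟩ <;> simp
    have e2 : c.drop (b :: u).length = c.tail.drop u.length := by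
      rcases c with _ | ⟨d, c⟩ <;> simp
    rw [e, e2]
    cases b
    · exact (Com.Runs.loop_false hk hbody hrest).of_eq rfl (by simp; omega)
    · exact (Com.Runs.loop_true hk hbody hrest).of_eq rfl (by simp; omega)

/-- Emit the accumulator doubled onto `x`: for each popped symbol `b`, push `b` twice.
[folklore] -/
def dblBody (b : Bool) : Com (O1 ⊕ AReg) := Com.push (Sum.inr .x) b ;; Com.push (Sum.inr .x) b

/-- **The doubling loop**: `x := dbl (accʳ) ++ x`, `acc` emptied. [folklore] -/
theorem runs_dblLoop (v : List Bool) : ∀ (xs ys : List Bool),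
    Com.Runs (Com.loop (Sum.inl O1.acc) (dblBody true) (dblBody false) : Com (O1 ⊕ AReg)) (Sum.elim (o1 v) (file xs ys [] [] [] [] [] []))
      (Sum.elim (o1 []) (file ((v.reverse.flatMap fun b => [b, b]) ++ xs) ys [] [] [] [] [] [])) (4 * v.length + 1) := by
  induction v with
  | nil => intro xs ys; exact (Com.Runs.loop_nil _ _ rfl).of_eq (by simp) (by simp)
  | cons b v ih =>
    intro xs ys
    have hk : (Sum.elim (o1 (b :: v)) (file xs ys [] [] [] [] [] []) : Regs (O1 ⊕ AReg)) (Sum.inl O1.acc) = b :: v := rfl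
    have hw : Function.update (Sum.elim (o1 (b :: v)) (file xs ys [] [] [] [] [] [])) (Sum.inl O1.acc : O1 ⊕ AReg) v =
        Sum.elim (o1 v) (file xs ys [] [] [] [] [] []) := by
      funext i; rcases i with i | i <;> cases i <;> rfl
    have hbody : ∀ d : Bool, Com.Runs (dblBody d) (Function.update (Sum.elim (o1 (b :: v)) (file xs ys [] [] [] [] [] [])) (Sum.inl O1.acc : O1 ⊕ AReg) v)
        (Sum.elim (o1 v) (file (d :: d :: xs) ys [] [] [] [] [] [])) 2 := fun d => by
      rw [hw]
      exact (Com.Runs.push' (R' := Sum.elim (o1 v) (file (d :: xs) ys [] [] [] [] [] [])) (by funext i; rcases i with i | i <;> cases i <;> rfl)).seq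
        (Com.Runs.push' (by funext i; rcases i with i | i <;> cases i <;> rfl))
    have hrest := fun d : Bool => ih (d :: d :: xs) ys
    have e : ((b :: v).reverse.flatMap fun b => [b, b]) ++ xs = (v.reverse.flatMap fun b => [b, b]) ++ (b :: b :: xs) := by simp
    rw [e]
    cases b
    · exact (Com.Runs.loop_false hk (hbody false) (hrest false)).of_eq rfl (by simp; omega)
    · exact (Com.Runs.loop_true hk (hbody true) (hrest true)).of_eq rfl (by simp; omega)

/-- The padded-block brick's routine: the block loop (block reversed on `acc`, rest on `y`),
move the rest onto `x`, push the separator `01`, emit the block doubled — leaving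
`boolPair block rest` on `x`. [folklore] -/
def padTakeC : Com (O1 ⊕ AReg) :=
  Com.loop (Sum.inr .x) padBody padBody ;; (Com.bk (Com.move .y .x .s) ;; ((Com.push (Sum.inr .x) true ;;
    Com.push (Sum.inr .x) false) ;; Com.loop (Sum.inl O1.acc) (dblBody true) (dblBody false)))

/-- `padTakeFn ⟨u, c⟩ = ⟨List.takeD |u| c false, c.drop |u|⟩`. [folklore] -/
def padTakeFn (w : List Bool) : List Bool :=
  boolPair (List.takeD (boolUnpair w).1.length (boolUnpair w).2 false) ((boolUnpair w).2.drop (boolUnpair w).1.length)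

/-- `padTakeFn` on a pair. [folklore] -/
@[simp] theorem padTakeFn_boolPair (u c : List Bool) :
    padTakeFn (boolPair u c) = boolPair (List.takeD u.length c false) (c.drop u.length) := by
  simp [padTakeFn]

/-- **`padTakeFn ∈ FP`.** [folklore] -/
theorem padTakeFn_mem_FP : padTakeFn ∈ FP := by
  refine binOp_mem_FP padTakeC (show (Sum.inr AReg.x : O1 ⊕ AReg) ≠ Sum.inr AReg.y by decide) (Sum.inr AReg.x)
    (fun u c => boolPair (List.takeD u.length c false) (c.drop u.length)) (fun n => 15 * n + 6) (15 * Polynomial.X + 6)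
    (fun n => by simp) (fun u c => ?_) (fun u c => ?_)
  · simp [boolPair, List.length_flatMap]; omega
  · rw [init2_o1, o1_nil]
    have h1 := runs_padLoop u c []
    rw [List.append_nil] at h1
    set blk := List.takeD u.length c false with hblk
    set rest := c.drop u.length with hrest
    have hrl : rest.length ≤ c.length := by rw [hrest]; simp
    have h2 : Com.Runs (Com.bk (Com.move .y .x .s) : Com (O1 ⊕ AReg)) (Sum.elim (o1 blk.reverse) (file [] rest [] [] [] [] [] []))
        (Sum.elim (o1 blk.reverse) (file rest [] [] [] [] [] [] [])) (6 * rest.length + 2) :=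
      ((Com.runs_move (a := AReg.y) (b := AReg.x) (t := AReg.s) (by decide) (by decide) (by decide)
        (file [] rest [] [] [] [] [] []) rfl).of_eq (R' := file rest [] [] [] [] [] [] []) (by simp) (B := 6 * rest.length + 2)
        (by simp)).inr _
    have h3 : Com.Runs (Com.push (Sum.inr .x) true ;; Com.push (Sum.inr .x) false : Com (O1 ⊕ AReg))
        (Sum.elim (o1 blk.reverse) (file rest [] [] [] [] [] [] [])) (Sum.elim (o1 blk.reverse) (file (false :: true :: rest) [] [] [] [] [] [] [])) 2 :=
      (Com.Runs.push' (R' := Sum.elim (o1 blk.reverse) (file (true :: rest) [] [] [] [] [] [] []))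
        (by funext i; rcases i with i | i <;> cases i <;> rfl)).seq
        (Com.Runs.push' (by funext i; rcases i with i | i <;> cases i <;> rfl))
    have h4 := runs_dblLoop blk.reverse (false :: true :: rest) []
    rw [List.reverse_reverse, List.length_reverse] at h4
    refine ⟨_, (h1.seq (h2.seq (h3.seq h4))).mono ?_, ?_⟩
    · have : blk.length = u.length := by rw [hblk, List.takeD_length]
      omega
    · simp [boolPair]

/-! ### Low bits -/

/-- The value of a prefix: `⟦v.take k⟧ = ⟦v⟧ mod 2^k` (corollary of
`StackArith.bitsToNat_take_add_drop`; twin of `Cryptography/SISFunctionMachine.bitsToNat_take_mod`,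
not importable here). [folklore] -/
theorem bitsToNat_take (v : List Bool) (k : ℕ) : bitsToNat (v.take k) = bitsToNat v % 2 ^ k := by
  have h := Com.bitsToNat_take_add_drop v k
  have hlt : bitsToNat (v.take k) < 2 ^ k := by
    refine (bitsToNat_lt _).trans_le (Nat.pow_le_pow_right (by norm_num) ?_)
    simp
  rw [← h, Nat.add_mul_mod_self_left, Nat.mod_eq_of_lt hlt]

/-- The low-bits loop's body: move one symbol of `y` onto the accumulator, if any. [folklore] -/
def lowBody : Com (O1 ⊕ AReg) :=
  Com.pop (Sum.inr .y) (Com.push (Sum.inl O1.acc) true) (Com.push (Sum.inl O1.acc) false) Com.skip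

/-- One iteration of the low-bits loop. [folklore] -/
theorem runs_lowBody (v c xs : List Bool) :
    Com.Runs lowBody (Sum.elim (o1 v) (file xs c [] [] [] [] [] []))
      (Sum.elim (o1 ((c.take 1).reverse ++ v)) (file xs c.tail [] [] [] [] [] [])) 3 := by
  rcases c with _ | ⟨b, c⟩
  · exact (Com.Runs.pop_nil _ _ rfl (Com.Runs.skip _)).of_eq (by simp) (by omega)
  · have hw : Function.update (Sum.elim (o1 v) (file xs (b :: c) [] [] [] [] [] [])) (Sum.inr AReg.y : O1 ⊕ AReg) c =
        Sum.elim (o1 v) (file xs c [] [] [] [] [] []) := by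
      funext i; rcases i with i | i <;> cases i <;> rfl
    have hp : ∀ d : Bool, Com.Runs (Com.push (Sum.inl O1.acc) d : Com (O1 ⊕ AReg)) (Sum.elim (o1 v) (file xs c [] [] [] [] [] []))
        (Sum.elim (o1 (d :: v)) (file xs c [] [] [] [] [] [])) 1 := fun d =>
      Com.Runs.push' (by funext i; rcases i with i | i <;> cases i <;> rfl)
    cases b
    · exact (Com.Runs.pop_false (k := (Sum.inr AReg.y : O1 ⊕ AReg)) _ _ (w := c) rfl (by rw [hw]; exact hp false)).of_eq
        (by simp) le_rfl
    · exact (Com.Runs.pop_true (k := (Sum.inr AReg.y : O1 ⊕ AReg)) _ _ (w := c) rfl (by rw [hw]; exact hp true)).of_eq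
        (by simp) le_rfl

/-- **The low-bits loop**: `acc = (v.take |u|)ʳ`, `y = v.drop |u|`. [folklore] -/
theorem runs_lowLoop (u : List Bool) : ∀ (c v : List Bool),
    Com.Runs (Com.loop (Sum.inr .x) lowBody lowBody : Com (O1 ⊕ AReg)) (Sum.elim (o1 v) (file u c [] [] [] [] [] []))
      (Sum.elim (o1 ((c.take u.length).reverse ++ v)) (file [] (c.drop u.length) [] [] [] [] [] [])) (5 * u.length + 1) := by
  induction u with
  | nil => intro c v; exact (Com.Runs.loop_nil _ _ rfl).of_eq (by simp) (by simp)
  | cons b u ih =>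
    intro c v
    have hk : (Sum.elim (o1 v) (file (b :: u) c [] [] [] [] [] []) : Regs (O1 ⊕ AReg)) (Sum.inr AReg.x) = b :: u := rfl
    have hw : Function.update (Sum.elim (o1 v) (file (b :: u) c [] [] [] [] [] [])) (Sum.inr AReg.x : O1 ⊕ AReg) u =
        Sum.elim (o1 v) (file u c [] [] [] [] [] []) := by
      funext i; rcases i with i | i <;> cases i <;> rfl
    have hbody : Com.Runs lowBody (Function.update (Sum.elim (o1 v) (file (b :: u) c [] [] [] [] [] [])) (Sum.inr AReg.x : O1 ⊕ AReg) u)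
        (Sum.elim (o1 ((c.take 1).reverse ++ v)) (file u c.tail [] [] [] [] [] [])) 3 := by
      rw [hw]; exact runs_lowBody v c u
    have hrest := ih c.tail ((c.take 1).reverse ++ v)
    have e : (c.take (b :: u).length).reverse ++ v = (c.tail.take u.length).reverse ++ ((c.take 1).reverse ++ v) := by
      rcases c with _ | ⟨d, c⟩ <;> simp
    have e2 : c.drop (b :: u).length = c.tail.drop u.length := by
      rcases c with _ | ⟨d, c⟩ <;> simp
    rw [e, e2]
    cases b
    · exact (Com.Runs.loop_false hk hbody hrest).of_eq rfl (by simp; omega)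
    · exact (Com.Runs.loop_true hk hbody hrest).of_eq rfl (by simp; omega)

/-- The low-bits brick's routine: the loop, discard the rest of `y`, pour the accumulator back
(restoring the order), normalise. [folklore] -/
def lowBitsC : Com (O1 ⊕ AReg) :=
  Com.loop (Sum.inr .x) lowBody lowBody ;; (Com.bk (Com.clear .y) ;; (Com.pour (Sum.inl O1.acc) (Sum.inr .x) ;; Com.bk Com.normalize))

/-- `lowBitsFn ⟨u, v⟩ = norm (v.take |u|)` — the numeral of `⟦v⟧ mod 2^{|u|}`. [folklore] -/
def lowBitsFn (w : List Bool) : List Bool := norm ((boolUnpair w).2.take (boolUnpair w).1.length)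

/-- `lowBitsFn` on a pair. [folklore] -/
@[simp] theorem lowBitsFn_boolPair (u v : List Bool) : lowBitsFn (boolPair u v) = norm (v.take u.length) := by
  simp [lowBitsFn]

/-- The value of `lowBitsFn`. [folklore] -/
theorem lowBitsFn_boolPair_eq_encodeNat (u v : List Bool) :
    lowBitsFn (boolPair u v) = encodeNat (bitsToNat v % 2 ^ u.length) := by
  rw [lowBitsFn_boolPair, norm_eq_encodeNat, bitsToNat_take]

/-- **`lowBitsFn ∈ FP`.** [folklore] -/
theorem lowBitsFn_mem_FP : lowBitsFn ∈ FP := by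
  refine binOp_mem_FP lowBitsC (show (Sum.inr AReg.x : O1 ⊕ AReg) ≠ Sum.inr AReg.y by decide) (Sum.inr AReg.x)
    (fun u v => norm (v.take u.length)) (fun n => 19 * n + 9) (19 * Polynomial.X + 9)
    (fun n => by simp) (fun u v => ?_) (fun u v => ?_)
  · have := length_norm_le (v.take u.length)
    have : (v.take u.length).length ≤ u.length := by simp
    simp; omega
  · rw [init2_o1, o1_nil]
    have h1 := runs_lowLoop u v []
    rw [List.append_nil] at h1
    set tk := v.take u.length with htk
    set rest := v.drop u.length with hrest
    have htl : tk.length ≤ u.length := by rw [htk]; simp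
    have hrl : rest.length ≤ v.length := by rw [hrest]; simp
    have h2 : Com.Runs (Com.bk (Com.clear .y) : Com (O1 ⊕ AReg)) (Sum.elim (o1 tk.reverse) (file [] rest [] [] [] [] [] []))
        (Sum.elim (o1 tk.reverse) (file [] [] [] [] [] [] [] [])) (2 * rest.length + 1) :=
      ((Com.runs_clear AReg.y (file [] rest [] [] [] [] [] [])).of_eq (R' := file [] [] [] [] [] [] [] []) (by simp)
        (B := 2 * rest.length + 1) (by simp)).inr _
    have h3 : Com.Runs (Com.pour (Sum.inl O1.acc) (Sum.inr .x) : Com (O1 ⊕ AReg)) (Sum.elim (o1 tk.reverse) (file [] [] [] [] [] [] [] []))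
        (Sum.elim (o1 []) (file tk [] [] [] [] [] [] [])) (3 * tk.length + 1) :=
      (Com.runs_pour (a := (Sum.inl O1.acc : O1 ⊕ AReg)) (b := Sum.inr AReg.x) (by simp) _).of_eq
        (by funext i; rcases i with i | i <;> cases i <;> simp [update_o1]) (by simp)
    have h4 : Com.Runs (Com.bk Com.normalize : Com (O1 ⊕ AReg)) (Sum.elim (o1 []) (file tk [] [] [] [] [] [] []))
        (Sum.elim (o1 []) (file (norm tk) [] [] [] [] [] [] [])) (9 * tk.length + 5) :=
      (Com.runs_normalize tk [] [] [] [] []).inr _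
    exact ⟨_, (h1.seq (h2.seq (h3.seq h4))).mono (by omega), rfl⟩

/-! ### Unary multiples -/

/-- `onesMulFn k w = 1^{k |w|}`. [folklore] -/
def onesMulFn (k : ℕ) (w : List Bool) : List Bool := List.replicate (k * w.length) true

/-- The unary-multiple brick's routine: `k` pushes per symbol of `x`, onto `y`. [folklore] -/
def onesMulC (k : ℕ) : Com AReg := Com.loop .x (Com.pushN .y true k) (Com.pushN .y true k)

/-- **`onesMulFn k ∈ FP`.** [folklore] -/
theorem onesMulFn_mem_FP (k : ℕ) : onesMulFn k ∈ FP := by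
  refine unOp_mem_FP (onesMulC k) AReg.x AReg.y (onesMulFn k) (fun n => (k + 2) * n + 1) (Polynomial.C (k + 2) * Polynomial.X + 1)
    (fun n => by simp) (fun a => ?_) (fun a => ?_)
  · simp [onesMulFn]; nlinarith
  rw [init1_bank]
  have key : ∀ (a v : List Bool), Com.Runs (onesMulC k) (file a v [] [] [] [] [] [])
      (file [] (List.replicate (k * a.length) true ++ v) [] [] [] [] [] []) ((k + 2) * a.length + 1) := by
    intro a
    induction a with
    | nil => intro v; exact (Com.Runs.loop_nil _ _ rfl).of_eq (by simp) (by simp)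
    | cons b a ih =>
      intro v
      have hk : (file (b :: a) v [] [] [] [] [] []) AReg.x = b :: a := rfl
      have hbody : Com.Runs (Com.pushN .y true k) (Function.update (file (b :: a) v [] [] [] [] [] []) AReg.x a)
          (file a (List.replicate k true ++ v) [] [] [] [] [] []) k := by
        rw [update_file_x]
        exact (Com.runs_pushN AReg.y true k _).of_eq (by simp) le_rfl
      have hrest := ih (List.replicate k true ++ v)
      have e : List.replicate (k * (b :: a).length) true ++ v = List.replicate (k * a.length) true ++ (List.replicate k true ++ v) := by
        rw [← List.append_assoc, ← List.replicate_add]; congr 2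
      rw [e]
      have hcost : k + 2 + ((k + 2) * a.length + 1) ≤ (k + 2) * (b :: a).length + 1 := by simp; ring_nf; omega
      cases b
      · exact (Com.Runs.loop_false hk hbody hrest).of_eq rfl hcost
      · exact (Com.Runs.loop_true hk hbody hrest).of_eq rfl hcost
  exact ⟨_, key a [], by simp [onesMulFn]⟩

end Brick

end Literature.Computability.Complexity
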